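import Mathlib
import HarnessLib
import Summits.HubbardSuperconductivity.HubbardSuperconductivity.Theorems.KLProgrammeKLRegimeTwoVolumeTowerTruncProfileBridgeS
import Summits.HubbardSuperconductivity.HubbardSuperconductivity.Theorems.KLProgrammeKLRegimeTwoVolumeSourceProfileKitF
import Summits.HubbardSuperconductivity.HubbardSuperconductivity.Theorems.KLProgrammeKLRegimeTwoVolumeSourceSmoothStateKit
import Summits.HubbardSuperconductivity.HubbardSuperconductivity.Theorems.KLProgrammeKLRegimeTwoVolumeSourceSmoothAnalysis
import Summits.HubbardSuperconductivity.HubbardSuperconductivity.Theorems.KLProgrammeKLRegimeTwoVolumeTowerGenericFacts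

/-!
# Route `KLProgramme` — crux K3, VL child `KLRegimeVolumeLimitV17F3` (stmt-HubbardSuperconductivity-23356), cure of LR13′ «(VL)-HUV-CURRENCY-PROPAGATION»,
# consumer step C1: THE SMOOTHED ONE-VOLUME PROFILE DIRECTLY FROM TOKEN #24-W (seat hubbard-kl-k3c4-p1 g20; `--supports` 23356)

`…TowerTruncProfileBridgeS.wtProfileEven_srcTrunc_klTowerDS_of_readout` builds the profile field of `TowerVolumeDataTS` (the rescaled PLAIN read-out
`klTowerDS … t j = srcScale t (klTowerD … j)`) from E1's alive read-out and PLAIN token #24; the windowed package `TowerVolumeDataTSW` was so far reached only by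
`…SourceSmoothProfile.TowerVolumeDataTS.smooth` (plain → windowed, constant `Cw`).  With token #24 in the windowed currency (producer
`…SrcTowerProducerF.srcProfilesHF_of_atomsT'` at `F = srcWindowFamily`) the smoothed profile is read DIRECTLY:
`klTowerDSW … t j = srcScale t (klTowerDF … srcWindowFamily j)` (`…SourceSmoothStateKit.klTowerDSW_eq_srcScale_srcSmooth`,
`…SourceSmoothAnalysis.srcSmooth_klTowerD_eq`, `…SourceProfileDefsF.klSrcAnalysisAtF_srcWindowFamily`).
* §1 `wtProfileEven_srcTrunc_srcScale_klTowerDF_of_srcPinnedSumAtF` / `…_of_readout` — the bridge at a generic source family `F` (the plain proof verbatim);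
* §2 `klTowerDSW_eq_srcScale_klTowerDF`, **`wtProfileEven_srcTrunc_klTowerDSW_of_readoutW`**, **`towerVolumeDataTSW_of_readoutW`** (twin of
  `…TowerVolumeDataTSOfReadout.towerVolumeDataTS_of_readout`, windowed currency, no `Cw`).
Proofs only; no definition.  Honest framing: conditional assembly; nothing here asserts the read-outs, the stub, K3 or superconductivity.
[cite: BenfattoGiulianiMastropietro2006, §2.7 (2.70)–(2.71), §2.9 (4.3)–(4.8)]
-/

noncomputable section

namespace Summit.HubbardSuperconductivity.HubbardSuperconductivity.Theorems.TwoVolumeSource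

set_option linter.dupNamespace false -- summit = problem name (single-conjunct summit), D-0017

open Finset Filter Topology Literature.MathematicalPhysics.QuantumLattice GrassmannAlgebra Literature.Probability.LatticeModels
  Literature.Probability.LatticeModels.BattleFederbush
open Summit.HubbardSuperconductivity.HubbardSuperconductivity.Theorems.TwoPointAssembly
open Summit.HubbardSuperconductivity.HubbardSuperconductivity.Theorems.KLRegimeSplit
open Summit.HubbardSuperconductivity.HubbardSuperconductivity.Theorems.KLProgrammeLegKernels
open Summit.HubbardSuperconductivity.HubbardSuperconductivity.Theorems.EngineV8
open Summit.HubbardSuperconductivity.HubbardSuperconductivity.Theorems.TwoVolumeDefect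

variable {V M : ℕ} [NeZero V] [NeZero M]

/-! ## §1 The bridge at a generic source family -/

/-- **`TowerVolumeDataTS.profile` FROM THE PRODUCERS' CURRENCY** (see the module docstring): bounds `S s m` on `klSrcPinnedSumAt … j r (j+1) s m q w` for
`s ≤ 2` give the weighted even profile of `srcTrunc 3 (srcScale t (klTowerDF … F j))`, `0 ≤ t`, at any rate `Λ ≤ Λ_r` with budget `ε · (S 0 (2m) + t·S 1 (2m) + t²·S 2 (2m))`.
[cite: BenfattoGiulianiMastropietro2006, §2.9 (4.3)-(4.8)] -/
theorem wtProfileEven_srcTrunc_srcScale_klTowerDF_of_srcPinnedSumAtF {β : ℝ} (hβ : 0 < β) (U μ : ℝ) (K : TrigPolyC4v) (F : Fin 1 → FreqMomentum V M → ℂ)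
    {t : ℝ} (ht : 0 ≤ t) (j r : ℕ) {Λ : ℝ}
    (hΛr : Λ ≤ klScale klE0 r) (S : ℕ → ℕ → ℝ) (hS0 : ∀ s m, 0 ≤ S s m)
    (h : ∀ s, s ≤ 2 → ∀ (m : ℕ) (q : Fin m) (w : SrcLabel V M j), klSrcPinnedSumAtF V M β U μ K F j r (j + 1) s m q w ≤ S s m) :
    WtProfileEven (srcTrunc ℂ (fun q : SrcLabel V M j => q.2 = 1) 3 (srcScale ℂ t (klTowerDF V M β U μ K F j))) Λ
      (fun m => imagTimeWeight β M * (S 0 (2 * m) + t * S 1 (2 * m) + t ^ 2 * S 2 (2 * m))) := by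
  classical
  have hε : 0 < imagTimeWeight β M := by
    have hM : (0 : ℝ) < M := Nat.cast_pos.2 (Nat.pos_of_ne_zero (NeZero.ne M))
    unfold imagTimeWeight; positivity
  refine ⟨fun m => mul_nonneg hε.le (add_nonneg (add_nonneg (hS0 0 _) (mul_nonneg ht (hS0 1 _))) (mul_nonneg (sq_nonneg t) (hS0 2 _))),
    fun m' jx x => ?_⟩
  -- degree `0` has no pin
  rcases m' with _ | m₁
  · exact jx.elim0
  -- abbreviations
  set D := klTowerDF V M β U μ K F j with hD
  set wt : (Fin (2 * (m₁ + 1)) → SrcLabel V M j) → ℝ := fun Y =>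
    1 + labelDiam (fun Y₁ Y₂ : SrcLabel V M j => Λ * (Torus.tnorm (Y₁.1.1.2 - Y₂.1.1.2) : ℝ)) (univ.image Y) with hwt
  set g : ℕ → (Fin (2 * (m₁ + 1)) → SrcLabel V M j) → ℝ := fun s Y =>
    if srcCount (fun q : SrcLabel V M j => q.2 = 1) Y = s then
      klScaleWt V M β r ((univ.image Y).image (srcLegPos V M (2 * (2 * M)))) * ‖kernel ℂ D (2 * (m₁ + 1)) Y‖ else 0 with hg
  have hwt0 : ∀ Y, 0 ≤ wt Y := fun Y => add_nonneg zero_le_one (labelDiam_nonneg _ _)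
  have hwtle : ∀ Y, wt Y ≤ klScaleWt V M β r ((univ.image Y).image (srcLegPos V M (2 * (2 * M)))) :=
    fun Y => one_add_labelDiam_mul_tnorm_le_klScaleWt_src hβ.le hΛr Y
  have hg0 : ∀ s Y, 0 ≤ g s Y := fun s Y => by
    simp only [hg]; split_ifs
    · exact mul_nonneg (zero_le_one.trans (one_le_klScaleWt _ _ _ _ _)) (norm_nonneg _)
    · exact le_rfl
  -- termwise: the rescaled truncated term is below `g 0 + t·g 1 + t²·g 2` (a string with `s` source legs carries `t^s`)
  have hterm : ∀ Y : Fin (2 * (m₁ + 1)) → SrcLabel V M j,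
      ‖kernel ℂ (srcTrunc ℂ (fun q : SrcLabel V M j => q.2 = 1) 3 (srcScale ℂ t D)) (2 * (m₁ + 1)) Y‖ * wt Y ≤
        g 0 Y + t * g 1 Y + t ^ 2 * g 2 Y := by
    intro Y
    have h0 := hg0 0 Y; have h1 := hg0 1 Y; have h2 := hg0 2 Y
    have hgs : ∀ s, srcCount (fun q : SrcLabel V M j => q.2 = 1) Y = s →
        g s Y = klScaleWt V M β r ((univ.image Y).image (srcLegPos V M (2 * (2 * M)))) * ‖kernel ℂ D (2 * (m₁ + 1)) Y‖ :=
      fun s hs => by simp only [hg, hs, if_true]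
    have hsc : ‖kernel ℂ (srcScale ℂ t D) (2 * (m₁ + 1)) Y‖ =
        t ^ srcCount (fun q : SrcLabel V M j => q.2 = 1) Y * ‖kernel ℂ D (2 * (m₁ + 1)) Y‖ := by
      rw [kernel_srcScale, norm_mul, norm_pow, RCLike.norm_ofReal, abs_of_nonneg ht]
    rw [kernel_srcTrunc]
    by_cases hlt : srcCount (fun q : SrcLabel V M j => q.2 = 1) Y < 3
    · rw [if_pos hlt, hsc]
      have hb : ‖kernel ℂ D (2 * (m₁ + 1)) Y‖ * wt Y ≤ klScaleWt V M β r ((univ.image Y).image (srcLegPos V M (2 * (2 * M)))) * ‖kernel ℂ D (2 * (m₁ + 1)) Y‖ := by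
        rw [mul_comm]; exact mul_le_mul_of_nonneg_right (hwtle Y) (norm_nonneg _)
      obtain hs | hs | hs : srcCount (fun q : SrcLabel V M j => q.2 = 1) Y = 0 ∨ srcCount (fun q : SrcLabel V M j => q.2 = 1) Y = 1 ∨
          srcCount (fun q : SrcLabel V M j => q.2 = 1) Y = 2 := by omega
      · rw [hs, pow_zero, one_mul, hgs 0 hs]
        linarith [mul_nonneg ht h1, mul_nonneg (sq_nonneg t) h2]
      · rw [hs, pow_one, hgs 1 hs]
        linarith [mul_le_mul_of_nonneg_left hb ht, mul_nonneg (sq_nonneg t) h2]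
      · rw [hs, hgs 2 hs]
        linarith [mul_le_mul_of_nonneg_left hb (sq_nonneg t), mul_nonneg ht h1]
    · rw [if_neg hlt, norm_zero, zero_mul]
      exact add_nonneg (add_nonneg h0 (mul_nonneg ht h1)) (mul_nonneg (sq_nonneg t) h2)
  -- the `g s` sums are `ε · klSrcPinnedSumAtF … s`
  have hsum : ∀ s, ∑ Y ∈ univ.filter (fun Y : Fin (2 * (m₁ + 1)) → SrcLabel V M j => Y jx = x), g s Y =
      imagTimeWeight β M * klSrcPinnedSumAtF V M β U μ K F j r (j + 1) s (2 * (m₁ + 1)) jx x := by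
    intro s
    simp only [hg]
    rw [← sum_filter, filter_filter]
    exact sum_srcCount_filter_eq_eps_mul_klSrcPinnedSumAtF hβ.le U μ K F j r s (2 * (m₁ + 1)) (by omega) jx x
  -- assemble
  calc ∑ Y ∈ univ.filter (fun Y : Fin (2 * (m₁ + 1)) → SrcLabel V M j => Y jx = x),
        ‖kernel ℂ (srcTrunc ℂ (fun q : SrcLabel V M j => q.2 = 1) 3 (srcScale ℂ t D)) (2 * (m₁ + 1)) Y‖ * wt Y
      ≤ ∑ Y ∈ univ.filter (fun Y : Fin (2 * (m₁ + 1)) → SrcLabel V M j => Y jx = x), (g 0 Y + t * g 1 Y + t ^ 2 * g 2 Y) :=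
        sum_le_sum fun Y _ => hterm Y
    _ = imagTimeWeight β M * (klSrcPinnedSumAtF V M β U μ K F j r (j + 1) 0 (2 * (m₁ + 1)) jx x +
          t * klSrcPinnedSumAtF V M β U μ K F j r (j + 1) 1 (2 * (m₁ + 1)) jx x + t ^ 2 * klSrcPinnedSumAtF V M β U μ K F j r (j + 1) 2 (2 * (m₁ + 1)) jx x) := by
        rw [sum_add_distrib, sum_add_distrib, ← mul_sum, ← mul_sum, hsum 0, hsum 1, hsum 2]; ring
    _ ≤ imagTimeWeight β M * (S 0 (2 * (m₁ + 1)) + t * S 1 (2 * (m₁ + 1)) + t ^ 2 * S 2 (2 * (m₁ + 1))) :=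
        mul_le_mul_of_nonneg_left (add_le_add (add_le_add (h 0 (by norm_num) _ jx x)
          (mul_le_mul_of_nonneg_left (h 1 (by norm_num) _ jx x) ht)) (mul_le_mul_of_nonneg_left (h 2 le_rfl _ jx x) (sq_nonneg t))) hε.le

/-- **The profile of the truncated, rescaled `F`-read-out FROM E1's READ-OUT ⊕ TOKEN #24-F**: budget `ε · (S₀ (2m) + t·S 1 (2m) + t²·S 2 (2m))`.
[cite: BenfattoGiulianiMastropietro2006, §2.9 (4.3)-(4.8)] -/
theorem wtProfileEven_srcTrunc_srcScale_klTowerDF_of_readout {β : ℝ} (hβ : 0 < β) (U μ : ℝ) (K : TrigPolyC4v) (F : Fin 1 → FreqMomentum V M → ℂ)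
    {t : ℝ} (ht : 0 ≤ t) (j r : ℕ) {Λ : ℝ}
    (hΛr : Λ ≤ klScale klE0 r) (S₀ : ℕ → ℝ) (S : ℕ → ℕ → ℝ) (hS₀ : ∀ m, 0 ≤ S₀ m) (hS : ∀ s m, 0 ≤ S s m)
    (h0 : ∀ (m : ℕ) (q : Fin m) (w : SpaceTimeIdx V M × SectorLeg (sectorCount j)),
      klWtPinnedSumAt V M β μ K j r m (klEffectiveAction V M β U μ K klE0 (j + 1)) q w ≤ S₀ m)
    (h12 : SourceProfilesAtLevF V M S β U μ K F j r (j + 1)) :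
    WtProfileEven (srcTrunc ℂ (fun q : SrcLabel V M j => q.2 = 1) 3 (srcScale ℂ t (klTowerDF V M β U μ K F j))) Λ
      (fun m => imagTimeWeight β M * (S₀ (2 * m) + t * S 1 (2 * m) + t ^ 2 * S 2 (2 * m))) := by
  have h := wtProfileEven_srcTrunc_srcScale_klTowerDF_of_srcPinnedSumAtF hβ U μ K F ht j r hΛr (fun s m => if s = 0 then S₀ m else S s m)
    (fun s m => by
      show 0 ≤ (if s = 0 then S₀ m else S s m)
      split_ifs; exacts [hS₀ m, hS s m])
    (fun s hs m q w => by
      show klSrcPinnedSumAtF V M β U μ K F j r (j + 1) s m q w ≤ (if s = 0 then S₀ m else S s m)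
      split_ifs with h0'
      · subst h0'; exact (klSrcPinnedSumAtF_zero_le_klWtPinnedSumAt hβ.le U μ K F j r (j + 1) m q w).trans (h0 m q w.1)
      · exact h12 s (by omega) hs m q w)
  simpa using h

/-! ## §2 The windowed instance: the profile field of `TowerVolumeDataTSW` directly from token #24-W -/

/-- **`klTowerDSW … t k = srcScale t (klTowerDF … srcWindowFamily k)`** (the smoothed rescaled read-out IS the rescaled read-out of the windowed family).
[cite: BenfattoGiulianiMastropietro2006, §2.9 (4.6)-(4.8)] -/
theorem klTowerDSW_eq_srcScale_klTowerDF {β : ℝ} (hβ : β ≠ 0) (U μ : ℝ) (K : TrigPolyC4v) (t : ℝ) (k : ℕ) :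
    klTowerDSW V M β U μ K t k = srcScale ℂ t (klTowerDF V M β U μ K (srcWindowFamily V M) k) := by
  rw [klTowerDSW_eq_srcScale_srcSmooth, srcSmooth_klTowerD_eq hβ, klTowerDF_def, klSrcAnalysisAtF_srcWindowFamily]

/-- **`TowerVolumeDataTSW.profile` FROM E1's READ-OUT ⊕ TOKEN #24-W** (no smoothing constant): budget `ε · (S₀ (2m) + t·S 1 (2m) + t²·S 2 (2m))`.
[cite: BenfattoGiulianiMastropietro2006, §2.9 (4.3)-(4.8)] -/
theorem wtProfileEven_srcTrunc_klTowerDSW_of_readoutW {β : ℝ} (hβ : 0 < β) (U μ : ℝ) (K : TrigPolyC4v) {t : ℝ} (ht : 0 ≤ t) (j r : ℕ) {Λ : ℝ}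
    (hΛr : Λ ≤ klScale klE0 r) (S₀ : ℕ → ℝ) (S : ℕ → ℕ → ℝ) (hS₀ : ∀ m, 0 ≤ S₀ m) (hS : ∀ s m, 0 ≤ S s m)
    (h0 : ∀ (m : ℕ) (q : Fin m) (w : SpaceTimeIdx V M × SectorLeg (sectorCount j)),
      klWtPinnedSumAt V M β μ K j r m (klEffectiveAction V M β U μ K klE0 (j + 1)) q w ≤ S₀ m)
    (h12 : SourceProfilesAtLevF V M S β U μ K (srcWindowFamily V M) j r (j + 1)) :
    WtProfileEven (srcTrunc ℂ (fun q : SrcLabel V M j => q.2 = 1) 3 (klTowerDSW V M β U μ K t j)) Λ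
      (fun m => imagTimeWeight β M * (S₀ (2 * m) + t * S 1 (2 * m) + t ^ 2 * S 2 (2 * m))) := by
  rw [klTowerDSW_eq_srcScale_klTowerDF hβ.ne']
  exact wtProfileEven_srcTrunc_srcScale_klTowerDF_of_readout hβ U μ K (srcWindowFamily V M) ht j r hΛr S₀ S hS₀ hS h0 h12

/-- **`TowerVolumeDataTSW` FROM THE DOORS' CONCLUSIONS, WINDOWED CURRENCY** at one instance `(V, M, K)` — twin of `…TowerVolumeDataTSOfReadout.towerVolumeDataTS_of_readout`
reading token #24-W (`SourceProfilesAtLevF … (srcWindowFamily V M) …`) DIRECTLY into the smoothed profile field (no `TowerVolumeDataTS.smooth`, no `Cw`).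
[cite: BenfattoGiulianiMastropietro2006, §2.9 (4.3)-(4.8)] -/
theorem towerVolumeDataTSW_of_readoutW {β : ℝ} (hβ : 0 < β) (U μ : ℝ) (K : TrigPolyC4v) (J : ℕ) {t : ℝ} (ht : 0 ≤ t)
    (Λ κ aW sW : ℕ → ℝ) (r : ℕ → ℕ) (hΛr : ∀ j, j ≤ J → Λ j ≤ klScale klE0 (r j))
    (hZ : ∀ k, k ≤ J → hubbardEffPartitionFnCT V M β U μ 0 K (klScale klE0 (k + 1)) ≠ 0)
    (hcov : ∀ j, j < J → ScaleCovData (klStepCov V M β μ K j) (Λ j) (κ j) (aW j / imagTimeWeight β M) (sW j))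
    (S₀ : ℕ → ℕ → ℝ) (S : ℕ → ℕ → ℕ → ℝ) (hS₀ : ∀ j m, 0 ≤ S₀ j m) (hS : ∀ j s m, 0 ≤ S j s m)
    (h0 : ∀ j, j ≤ J → ∀ (m : ℕ) (q : Fin m) (w : SpaceTimeIdx V M × SectorLeg (sectorCount j)),
      klWtPinnedSumAt V M β μ K j (r j) m (klEffectiveAction V M β U μ K klE0 (j + 1)) q w ≤ S₀ j m)
    (h12 : ∀ j, j ≤ J → SourceProfilesAtLevF V M (S j) β U μ K (srcWindowFamily V M) j (r j) (j + 1)) :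
    TowerVolumeDataTSW V M β U μ K J (imagTimeWeight β M) t Λ κ aW sW
      (fun j m => S₀ j (2 * m) + t * S j 1 (2 * m) + t ^ 2 * S j 2 (2 * m)) where
  Z k hk := hZ k (by omega)
  parity j hj := klTowerD_parity β U μ K j (hZ j hj)
  cov := hcov
  profile j hj := wtProfileEven_srcTrunc_klTowerDSW_of_readoutW hβ U μ K ht j (r j) (hΛr j hj) (S₀ j) (S j) (hS₀ j) (hS j) (h0 j hj) (h12 j hj)

end Summit.HubbardSuperconductivity.HubbardSuperconductivity.Theorems.TwoVolumeSource

end
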